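import Summits.HodgeConjecture.HodgeConjecture.Theorems.F0P6bFlatQuotient   -- ★ p854176 T2′: the gate-checked twin of ED. 4 (namespace `…Cruxes.HLiu418.F0P6bFlatQuotient`)
import HarnessLib
import HarnessLib.Audit.LibrarySuggestionsDenyListCruxes

/-! # ED. 5 = ★-IMAGE EDITION of ED. 4 (sha16 bbf80a92f17c1846, 321 l., commit bc55e28504c2; hub BUILT 2026-09-03 12:21:40Z s0) — desk F0P6b-plan (g15) CANDIDATE 2026-09-03 — UNWRITTEN. LEAD «M-153u» (1) 12:17:25Z: «the three `Lines` files stay the crux workfiles of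
record, NO `Lines` edition tonight (★-image editions = heir's optional hygiene in a later epoch)» ⇒ this text goes to `ledger crux write` ONLY on a LEAD word,
importee-first (№1 → №2 → parent), one edition per file per epoch.
Every theorem of ED. 4 keeps its NAME, its DOCSTRING and its STATEMENT byte for byte; every BODY is re-pointed BY NAME to the gate-checked twin
★ p854176 `Theorems/F0P6bFlatQuotient.lean` (sha16 27f2f892d346d4af; «P6b-REHOME» T2′, LEAD «M-153u» (4), books v9.05), whose §Q body is the
Literature re-home ★ p854169 `AbelianSchemes/CechH1CountOfFiniteFlatQuotient` (F1) and whose §D body is ★ p854124 `MumfordPoincareOfFiniteFlatKernel` ED. 2.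
Imports: the twin alone (these statements ARE the twin's statements, so its imports elaborate them); the 25-module import list of ED. 4 served the
in-file torsor-quotient proof and leaves with it. Importer unchanged: `Lines/F0_P6b_SerreTateSigma2.lean` (its head `stub_L4B1es_of_sigma2` names
`F0P6bMumfordDualFlat.stub_L4B1uQ_quotientByFiniteFlatSubgroup` in its statement).
The proofs now live ONCE, in `Theorems/` ∕ `Literature/`; this `Lines` file remains their crux-workfile record BY NAME (same names, same
docstrings, same statements), so every by-name reader, card locator and SAME-STATEMENT junction is unchanged. No instance, no notation, no axiom,
no `sorry`. Count-neutral: HC_CM is proved only modulo the printed citations until rung 0 closes; nothing here changes that count. -/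
/-!
# F0 · P6b — sub-line «FLATQUOT» of the banked socket §1 `stub_L4B1u_abelianLiftOfIsUnitTwo` (`Lines/F0_P6b_BTSerreTate.lean`, ED. 4):
# the Mumford dual `Â = A⁄K(L)` by the FINITE FLAT (not necessarily étale) group scheme `K(L)`, ANY CHARACTERISTIC — DESK ED. 1

Crux HLiu418 = `stmt-HodgeConjecture-24832` on `route-HodgeConjecture-HCCMUnconditional`; cell `pub/hodgecm-mathlib`; programme P6 «MOD» (MOD-PLAN
v0.9 §4 Row 4, road 4B); parent line `Lines/F0_P6b_BTSerreTate.lean` ED. 4 (623d4515a513; banked 2 = 2: §1 `stub_L4B1u_abelianLiftOfIsUnitTwo`, §2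
`stub_L4B1es_serreTateLift`).  Desk F0P6b-plan (g12), census (O4) «FLATQUOT» of desk F0P6b-plan (g11) (`F0/P6/F0P6b-plan/g11/CENSUS-O4-FLATQUOT.v0…md`).
HONEST LABEL: HC_CM is proved only modulo the printed citations (2 remaining named inputs hLiu418 24832, h413 24833) until rung 0 closes; this
sub-line changes no count: it re-expresses the parent's banked §1 as TWO named print stubs + kernel-checked glue, and is a pure ADDITION (no socket
of the parent is re-cut; the parent does not import this file).

## Idea (one paragraph)
By the parent's junction §1b (`stub_L4B1u_of_cechH1Count`, kernel-checked over ★ p852865 `AbelianLiftOfIsUnitTwo`) the banked abelian-lifting socket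
§1 is, BY TYPE, the H¹-count letter `hH1 : dim B ≤ dim_k Ȟ¹(𝔘, 𝒪_B) + 1` for EVERY abelian scheme `B` over EVERY field `k` away.  In characteristic `0`
and for separably polarised `B` the count is ★ (`CechH1CountOfPoincareDataHead`: Mumford's dual by the CONSTANT group `K(L)`, `n ∈ k^×`); in
characteristic `p` in general `K(L)` is a finite NON-étale group scheme and the only print road is [MumfordAV1970] §13 itself: `Â := A⁄K(L)` by §12
Thm. 1 (quotient by a finite group scheme) and the descent of the Mumford bundle `Λ(L)` to the Poincaré sheaf on `A × Â`.  Everything AROUND those two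
steps is ★ and paid in ★ `CechH1CountOfFlatPoincareData` (desk F0P6b-plan (g12)): the rigidified `L = 𝒪(Θ)` of ample geometric class (§1 there),
`K(L)` a finite closed subgroup scheme (§2), the head [MumfordAV1970] §13 Cor. 2 from FLAT Poincaré data (§3) and the descent of the count from `k̄` to
`k` (§4).  So §1 of the parent = { `stub_L4B1uQ_quotientByFiniteFlatSubgroup`, `stub_L4B1uD_mumfordLambdaDescent` } + glue, kernel-checked below
(`stub_L4B1u_of_flatQuotient_of_descent : (Q) → (D) → ⟨the §1 socket statement, verbatim⟩`; ED. 2: the parent ED. 5 pays §1 BY TERM over it).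

## Sockets (banked, `sorry` only here; statements FIXED — provers re-prove nothing else)
* §Q `stub_L4B1uQ_quotientByFiniteFlatSubgroup` — **QUOTIENT OF AN ABELIAN SCHEME BY A FINITE FLAT CLOSED SUBGROUP SCHEME** over a Noetherian affine
  base `Spec R`, for an abelian scheme whose finite sets of points lie in affine opens (automatic over a field, ★ `exists_isAffineOpen_forall_mem_of_isProjective`;
  automatic over an Artin local ring): given a closed immersion `i : Z ↪ A` with `Z → Spec R` finite flat, stable under unit ∕ product ∕ inverse, there is an
  abelian scheme `Â` over `Spec R` and a homomorphism `π : A → Â`, FINITE, FLAT, SURJECTIVE, with `u ≫ π = 1 ↔ u` factors through `Z` on `T`-points, and `Â`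
  of relative dimension `g` when `A` is ([SGA3I] Exp. V Thm. 4.1 ∕ [GortzWedhorn2023] Thm. 27.68 + Prop. 27.62: `A⁄Z` is a scheme, `A → A⁄Z` an fppf
  `Z`-torsor, `A⁄Z` smooth with geometrically connected fibres; [MumfordAV1970] §12 Thm. 1 (p. 111) over a field; [GortzWedhorn2023] Cor. 27.177 (1)).
  Stated over a BASE because the same organ serves the parent's §2′ (Serre–Tate essential surjectivity: `A := B⁄K`, [Katz1981SerreTate] Thm. 1.2.1).
* §D `stub_L4B1uD_mumfordLambdaDescent` — **DESCENT OF `Λ(L)` TO THE POINCARÉ SHEAF** over `K = K̄`: for `π : A → Â` a finite flat surjective homomorphism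
  of abelian schemes with kernel `K(L)` (`L` rank one, rigidified along the unit section) there is `𝒫` rank one on `A × Â` with `(1 × π)^*𝒫 ≅ Λ(L)` and every
  slice `𝒫|_{A × {b}}` in `Pic⁰` ([MumfordAV1970] §13, proof of the Theorem (pp. 125–127): `Λ(L)|_{A × K(L)}` is canonically trivial, the cocycle
  condition by rigidity; §8 (p. 77) for the slices `t_a^*L ⊗ L⁻¹ ∈ Pic⁰`).  The ★ twin for CONSTANT `K(L)` is `MumfordQuotientPoincare` (descent along a
  free quotient by a finite GROUP, ★ `RelativeSpec/EquivariantModuleDescent`); the new content is fppf descent of a rank-one module along a finite FLAT torsor.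

## Kernel-checked glue (no `sorry` outside the two stubs)
* `forall_flatPoincareData_of_stubs : (Q) → (D) → «flat Poincaré data over every algebraically closed field»` (the hypothesis of ★
  `MumfordDual.hH1_of_forall_flatPoincareData`): ★ `exists_rankOne_kOfL_closedSubgroup` (the `L` and its finite closed subgroup scheme `K(L)`), ★
  projectivity of abelian varieties (`AbelianVariety.isProjectiveOver_holds`, `Morphisms.IsProjective.of_isProjectiveOver`,
  `Morphisms.exists_isAffineOpen_forall_mem_of_isProjective`), flatness of `K(L) → Spec K` (Mathlib: one-point integral base), then (Q), then (D).
* `stub_L4B1u_of_flatQuotient_of_descent : (Q) → (D) → ⟨§1 `stub_L4B1u_abelianLiftOfIsUnitTwo` statement, verbatim⟩` — ★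
  `MumfordDual.hH1_of_forall_flatPoincareData` + ★ p852865 `AbelianSchemeOver.exists_abelianLift_of_isUnit_two` (the parent's §1b road, inlined).

## Mathlib ∕ ★ reuse map (for the provers of §Q ∕ §D)
Mathlib: `AlgebraicGeometry.IsClosedImmersion`, `IsFinite`, `Flat`, `Surjective`, `IsAffineOpen`, `CartesianMonoidalCategory` on `Over (Spec R)`,
`MonObj`/`GrpObj`/`IsMonHom`/`IsCommMonObj` (group objects and homomorphisms), `Scheme.Modules.pullback`, fpqc ∕ flat descent files
`Mathlib/AlgebraicGeometry/Morphisms/{FlatDescent,LocalFlatDescent,Descent}.lean`.  ★ tree: `RelativeSpec/{FreeQuotient*,GeometricQuotient*,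
FiniteGroupQuotient*,EquivariantModuleDescent*,DescentOfUnitAlongFreeQuotient}` (the CONSTANT-group road, the template to generalise),
`GroupSchemes/{ActionKernelLocusFiniteFlat,GroupSchemeActionOfPoints,FiniteFlatGroupScheme*}` (actions `γ[G, X]` on points, finite flat group
schemes), `AbelianSchemes/{AbelianSchemeKOfL,AbelianSchemeKOfLSeesaw,AbelianSchemeKOfLClosedSubscheme,AbelianSchemeKOfLFinite,AbelianSchemeKOfLFlat,
MumfordQuotientConstruction*,MumfordQuotientPoincare,MumfordQuotientSliceInjective,CechH1DimOfPoincareData,CechH1CountOfFlatPoincareData}`,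
`Morphisms/{FlatOfFlatFibres,SmoothOfFlatSurjectiveSmoothSource,FlatFpqcDescent}`, `Motives/AbelianVarietyIsogenyGeometricQuotient` (Mumford §7 Thm. 4
by recognition, over `ℂ`).

## References
* [MumfordAV1970] D. Mumford, *Abelian Varieties* (1970), §12 Thm. 1 (p. 111); §13 (p. 123), Theorem (p. 125), its proof (pp. 125–129) and Cor. 2
  (p. 129); §8 (p. 77); §7 Thm. 4 (p. 72).
* [SGA3I] M. Demazure, A. Grothendieck, *Schémas en groupes I* (SGA 3, Tome I), LNM 151 (1970), Exp. V (P. Gabriel, «Construction de schémas quotients») Thm. 4.1; Exp. VI_A Thm. 3.2.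
* [GortzWedhorn2023] U. Görtz, T. Wedhorn, *Algebraic Geometry II* (2023), Thm. 27.68, Prop. 27.62, Prop. 27.176 and Cor. 27.177 (1).
* [Katz1981SerreTate] N. Katz, *Serre–Tate local moduli* (1981), Thm. 1.2.1 (essential surjectivity: `A := B⁄K`).
* [Oort1971] F. Oort, *Finite group schemes, local moduli for abelian varieties, and lifting problems* (1971), Theorem (2.2.1) (p. 273).

ED. 2 (DAYLIGHT re-cut «M-149e» (2), desk F0P6b-plan (g12) candidate): import edge to the parent INVERTED — this file no longer imports
`Lines/F0_P6b_BTSerreTate`; it imports ★ `AbelianSchemes/AbelianLiftOfIsUnitTwo` (p852865) and states the junction's conclusion verbatim; the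
parent ED. 5 imports this file and pays §1 BY TERM.  Statement texts of `stub_L4B1uQ_…` ∕ `stub_L4B1uD_…` ∕ `forall_flatPoincareData_of_stubs`
BYTE-IDENTICAL to ED. 1; sorries 2 = 2.
ED. 3 (desk F0P6b-plan (g14); RE-CUT «D-g14-1» LEAD-approved + §Q PAID BY ★ TERM, count-neutral organs of waves A∕B on `--supports
stmt-HodgeConjecture-24832`): (a) the binder `[IsLocalRing R]` is inserted in §Q after `[IsNoetherianRing R]` (the consumers `forall_flatPoincareData_of_stubs` ∕
`stub_L4B1u_of_flatQuotient_of_descent` instantiate `R := K` a field — unchanged); (b) the `sorry` of §Q `stub_L4B1uQ_quotientByFiniteFlatSubgroup` is replaced by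
the §Q junction (JQ rehearsal sheet v6, «LH5» LH5-p05 (g15)) over ★ `TorsorQuotientKernel.Over.exists_grpObj_isMonHom_of_factors` (Q1),
★ `TranslationAction.isFreeAction_of_isClosedImmersion_left` ∕ `isClosedImmersion_lift_act_snd_left` (g1), ★ `AffineGroupScheme.isAffine_and_moduleFinite_and_moduleFree` (Q2),
★ `ActionOrbit.forall_exists_stable_isAffineOpen_of_free` (N3), ★ `FiniteFlatQuotientAffine.Chart.exists_chart` (QB4) over ★ `AffineGroupScheme.coaction` (P2),
★ `RelativeSpec.TorsorQuotient.exists_chartedQuotientDatum` (CQD gluing, (7)), ★ `RelativeSpec.TorsorQuotientGlobal.*_of_chartedQuotient` ((8)),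
★ `GroupSchemes.TorsorQuotient.exists_grpObj_isMonHom_of_isPullback` (Q8), ★ `GroupSchemes.TorsorQuotientKernel.Over.comp_eq_one_iff` (Q9),
★ `smooth_hom_of_isFinite_flat_surjective` ∕ `isProper_hom_of_surjective` ∕ `geometricallyConnected_hom_of_surjective` ∕
`smoothOfRelativeDimension_hom_of_isFinite_surjective` (Q10).  No other statement is touched; decls unchanged; code-`sorry` 2 → 1 — the ONE open leaf of
this file (and of P6b) is §D `stub_L4B1uD_mumfordLambdaDescent` (BANKED; wave C pays it by organs).
ED. 4 (desk F0P6b-plan (g14); LEAD «M-153p» (2) window «D-g14-3»; §D PAID BY ★ TERM, count-neutral organs of wave C on `--supports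
stmt-HodgeConjecture-24832`): the `sorry` of §D `stub_L4B1uD_mumfordLambdaDescent` is replaced by ONE application of the ★ head
`AbelianSchemeOver.exists_poincare_of_finiteFlatKernel` (★ `AbelianSchemes/MumfordPoincareOfFiniteFlatKernel` ED. 2, F0P3a-p09 (g26)) — itself assembled from
★ `AbelianSchemeOver.nonempty_linearisation_mumfordBundle` (Dβ, «LH6» LH6-p01 (g8): `ProductSliceRigidity` ∕ `LinearisationRigidDescent` ∕ `MumfordBundleSchemeLinearisation`
over ★ `Modules/SchemeLinearisation` and ★ `MumfordBundleKernelTranslationIso`), ★ `TorsorQuotient.exists_descent_of_linearisation` (Dδ generic half over ★ (ii)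
`TorsorQuotientModuleChart` ∕ `TorsorQuotientModuleChartUnit` ∕ `TorsorQuotientModuleChartCocycle` ∕ `RingTheory/Flat/ModuleDescentData`, ★ (iii) `TorsorQuotientModuleDescent` over ★ (i)
`SchemeEquivariantModuleInvariants`, ★ `TorsorQuotientModuleChartProjective`, ★ `ActionTripleSquare`), ★ Dα `TorsorSquareOfKernel` and ★ §1 `exists_poincare_of_descent_mumfordBundle`.
No statement is touched; decls unchanged; code-`sorry` 1 → 0 — this file, and with it the P6b line (`F0_P6b_BTSerreTate` ⟵ this file + `F0_P6b_SerreTateSigma2` ED. 5), is `sorry`-FREE.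
-/

noncomputable section

set_option autoImplicit false
set_option linter.dupNamespace false  -- `Summit.HodgeConjecture.HodgeConjecture.…` BY DESIGN (D-0017), as in the parent line

-- `Scheme.Modules` / cartesian-monoidal `Over` products agree only at default transparency (as in ★ `CechH1DimOfPoincareData`).
set_option backward.isDefEq.respectTransparency false

open CategoryTheory CategoryTheory.Limits AlgebraicGeometry MonoidalCategory CartesianMonoidalCategory IsLocalRing
open scoped MonObj

namespace Summit.HodgeConjecture.HodgeConjecture.Cruxes.HLiu418.F0P6bMumfordDualFlat

open Literature.AlgebraicGeometry.AbelianSchemes Literature.AlgebraicGeometry.Motives Literature.AlgebraicGeometry.AbelianVarieties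
open Literature.AlgebraicGeometry.Modules Literature.AlgebraicGeometry

/-! ## §Q (BANKED) Quotient of an abelian scheme by a finite flat closed subgroup scheme -/

/-- **§Q `stub_L4B1uQ` (PAID BY ★ TERM, ED. 3 — [SGA3I] Exp. V Thm. 4.1, [GortzWedhorn2023] Thm. 27.68 + Prop. 27.62, [MumfordAV1970] §12 Thm. 1).**  Over a
Noetherian LOCAL affine base `Spec R` (ED. 3 re-cut «D-g14-1»: `[IsLocalRing R]`), let `A` be an abelian scheme whose finite sets of points lie in affine opens (automatic over a field or an Artin local
ring), and `i : Z ↪ A` a closed immersion with `Z → Spec R` FINITE and FLAT through which the unit, the product of the two projections and the inverse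
factor (a finite flat closed subgroup scheme).  Then there is an abelian scheme `Â` over `Spec R` and a homomorphism `π : A → Â` which is FINITE, FLAT
and SURJECTIVE, whose kernel on `T`-valued points is exactly `Z` (`u ≫ π = 1 ↔ u` factors through `i`), and `Â` has relative dimension `g` whenever `A`
has: `Â := A⁄Z` is a scheme and `A → A⁄Z` an fppf `Z`-torsor (Thm. 27.68), `A⁄Z → Spec R` proper, flat, smooth with geometrically connected fibres
(Prop. 27.62 (4)) with the descended commutative group law, and `π` is an isogeny (Cor. 27.177 (1)).  Why it might fail: only by mis-statement — the
affine-orbit hypothesis is exactly SGA 3 V 4.1 (b); size XL (the ★ constant-group road `RelativeSpec/FreeQuotient*` ∕ `MumfordQuotientConstruction*` is the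
template). [cite: SGA3I, Exp. V Thm. 4.1] [cite: GortzWedhorn2023, Thm. 27.68, Prop. 27.62 and Cor. 27.177 (1)] [cite: MumfordAV1970, §12 Thm. 1 (p. 111)] -/
theorem stub_L4B1uQ_quotientByFiniteFlatSubgroup :
    ∀ (R : Type) [CommRing R] [IsNoetherianRing R] [IsLocalRing R] (A : AbelianSchemeOver (Spec (.of R))),
      (∀ F : Finset A.X.left, ∃ U : A.X.left.Opens, IsAffineOpen U ∧ ∀ x ∈ F, x ∈ U) →
      ∀ (Z : Over (Spec (.of R))) (i : Z ⟶ A.X), IsClosedImmersion i.left → IsFinite Z.hom → Flat Z.hom →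
        (∃ e : 𝟙_ (Over (Spec (.of R))) ⟶ Z, e ≫ i = 1) →
        (∃ m : Z ⊗ Z ⟶ Z, m ≫ i = (fst Z Z ≫ i) * (snd Z Z ≫ i)) →
        (∃ n : Z ⟶ Z, n ≫ i = i⁻¹) →
        ∃ (hat : AbelianSchemeOver (Spec (.of R))) (π : A.X ⟶ hat.X) (_ : IsMonHom π) (_ : IsFinite π.left) (_ : Flat π.left)
          (_ : Surjective π.left),
          (∀ (T : Over (Spec (.of R))) (u : T ⟶ A.X), u ≫ π = 1 ↔ ∃ v : T ⟶ Z, v ≫ i = u) ∧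
          ∀ g : ℕ, A.IsOfRelDim g → hat.IsOfRelDim g :=
  -- ★-IMAGE: PAID BY ★ TERM — twin ★ p854176 `Theorems/F0P6bFlatQuotient.lean` (T2′)
  F0P6bFlatQuotient.stub_L4B1uQ_quotientByFiniteFlatSubgroup

/-! ## §D (PAID BY ★ TERM, ED. 4) Descent of the Mumford bundle `Λ(L)` to the Poincaré sheaf on `A × A⁄K(L)` -/

/-- **§D `stub_L4B1uD` (PAID BY ★ TERM, ED. 4 — [MumfordAV1970] §13, proof of the Theorem (pp. 125–127); §8 (p. 77)).**  Over an algebraically closed field `K`, let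
`π : A → Â` be a FINITE FLAT SURJECTIVE homomorphism of abelian schemes whose kernel on `T`-valued points is `K(L)` for a rank-one `L` on `A` rigidified
along the unit section.  Then there is a rank-one `𝒫` on `A × Â` with `(1 × π)^*𝒫 ≅ Λ(L) = m^*L ⊗ pr₁^*L⁻¹ ⊗ pr₂^*L⁻¹` and every slice `𝒫|_{A × {b}}`
(`b ∈ Â(K)`) in `Pic⁰(A)`: `1 × π : A × A → A × Â` is an fppf `{0} × K(L)`-torsor (`Â ≅ A⁄K(L)`, [GortzWedhorn2023] Prop. 27.176), `Λ(L)|_{A × K(L)}` is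
trivial by the definition of `K(L)` and canonically so by the rigidification, the cocycle condition holds by rigidity (`A` proper and connected), and
the slice over `b = π(a)` pulls back to `Λ(L)|_{A × {a}} ≅ t_a^*L ⊗ L⁻¹ ∈ Pic⁰`.  Why it might fail: the descent datum must be the RIGIDIFIED
trivialisation (an arbitrary one is off by a character of `K(L)`); size L–XL (★ twin for constant `K(L)`: `MumfordQuotientPoincare`; new organ: descent of a
rank-one module along a finite FLAT torsor, Mathlib `Morphisms/FlatDescent`). [cite: MumfordAV1970, §13 Theorem (p. 125) and its proof (pp. 125–127); §8 (p. 77)]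
[cite: GortzWedhorn2023, Prop. 27.176 and Prop. 27.62 (2)] -/
theorem stub_L4B1uD_mumfordLambdaDescent :
    ∀ (K : Type) [Field K] [IsAlgClosed K] (A hat : AbelianSchemeOver (Spec (.of K))) (π : A.X ⟶ hat.X),
      IsMonHom π → IsFinite π.left → Flat π.left → Surjective π.left →
      ∀ (L : A.left.Modules) (hL : HasRank L 1),
        CechPic.pullback A.unitSection (detClass (HasRank.isFiniteLocallyFree' hL)) = 1 →
        (∀ (T : Over (Spec (.of K))) (u : T ⟶ A.X), u ≫ π = 1 ↔ A.MemKOfL L u) →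
        ∃ (P : (A.prodLeft hat).Modules) (_ : HasRank P 1),
          (∀ b : Spec (.of K) ⟶ hat.X.left,
            IsHomogeneous (A.fibre (b ≫ hat.X.hom)).toAbelianVariety ((Scheme.Modules.pullback (A.fibreSlice hat b)).obj P)) ∧
          Nonempty ((Scheme.Modules.pullback (A.X ◁ π).left).obj P ≅ A.mumfordBundle L) :=
  -- ★-IMAGE: PAID BY ★ TERM — twin ★ p854176 `Theorems/F0P6bFlatQuotient.lean` (T2′)
  F0P6bFlatQuotient.stub_L4B1uD_mumfordLambdaDescent

/-! ## Glue (kernel-checked; no `sorry` below this line) -/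

/-- **FLAT POINCARÉ DATA OVER EVERY ALGEBRAICALLY CLOSED FIELD, from §Q and §D** — the hypothesis of ★ `MumfordDual.hH1_of_forall_flatPoincareData`:
★ `exists_rankOne_kOfL_closedSubgroup` gives `L` (rank one, rigidified, ample class on geometric fibres) with `K(L)` a finite closed subgroup scheme
`Z ↪ A`; `Z → Spec K` is flat (field base) and finite sets of points of the projective `A` lie in affine opens (★ `AbelianVariety.isProjectiveOver_holds`,
★ `Morphisms.exists_isAffineOpen_forall_mem_of_isProjective`); §Q gives `(Â, π)` with kernel `Z = K(L)` and `Â` of relative dimension `g`; §D gives `𝒫`.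
[cite: MumfordAV1970, §13 Theorem (p. 125) and §12 Thm. 1 (p. 111)] -/
theorem forall_flatPoincareData_of_stubs
    (hQ : type_of% @stub_L4B1uQ_quotientByFiniteFlatSubgroup) (hD : type_of% @stub_L4B1uD_mumfordLambdaDescent) :
    ∀ (K : Type) [Field K] [IsAlgClosed K] (A : AbelianSchemeOver (Spec (.of K))) (g : ℕ), A.IsOfRelDim g →
      ∃ (L : A.left.Modules) (hL : HasRank L 1) (_ : CechPic.pullback A.unitSection (detClass (HasRank.isFiniteLocallyFree' hL)) = 1)
        (hat : AbelianSchemeOver (Spec (.of K))) (_ : hat.IsOfRelDim g) (π : A.X ⟶ hat.X) (_ : IsMonHom π) (_ : Flat π.left)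
        (_ : Surjective π.left) (P : (A.prodLeft hat).Modules) (_ : HasRank P 1),
        (∀ (T : Over (Spec (.of K))) (u : T ⟶ A.X), u ≫ π = 1 ↔ A.MemKOfL L u) ∧
        (∀ b : Spec (.of K) ⟶ hat.X.left,
          IsHomogeneous (A.fibre (b ≫ hat.X.hom)).toAbelianVariety ((Scheme.Modules.pullback (A.fibreSlice hat b)).obj P)) ∧
        Nonempty ((Scheme.Modules.pullback (A.X ◁ π).left).obj P ≅ A.mumfordBundle L) :=
  -- ★-IMAGE: PAID BY ★ TERM — twin ★ p854176 `Theorems/F0P6bFlatQuotient.lean` (T2′)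
  F0P6bFlatQuotient.forall_flatPoincareData_of_stubs hQ hD

/-- **THE PARENT'S BANKED SOCKET §1 FROM §Q AND §D (kernel-checked junction).**  `stub_L4B1u_abelianLiftOfIsUnitTwo` of
`Lines/F0_P6b_BTSerreTate.lean` — unconditional abelian lifting over Artin local bases with `2 ∈ A^×` — follows from the quotient stub §Q and the descent
stub §D: ★ `MumfordDual.hH1_of_forall_flatPoincareData` turns their flat Poincaré data into the H¹-count letter `dim B ≤ dim_k Ȟ¹(𝔘, 𝒪_B) + 1` for every
abelian scheme over every field, and ★ p852865 `AbelianSchemeOver.exists_abelianLift_of_isUnit_two` (the parent's §1b road) does the rest.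
ED. 2 (DAYLIGHT re-cut): the conclusion is the §1 socket statement SPELLED OUT (no `type_of%` into the parent, which now imports THIS file and
pays §1 BY TERM: `theorem stub_L4B1u_abelianLiftOfIsUnitTwo … := F0P6bMumfordDualFlat.stub_L4B1u_of_flatQuotient_of_descent stub_L4B1uQ_… stub_L4B1uD_…`).
[cite: MumfordAV1970, §13 Cor. 2 (p. 129)] [cite: Oort1971, Theorem (2.2.1) (p. 273)] -/
theorem stub_L4B1u_of_flatQuotient_of_descent
    (hQ : type_of% @stub_L4B1uQ_quotientByFiniteFlatSubgroup) (hD : type_of% @stub_L4B1uD_mumfordLambdaDescent) :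
    ∀ (A : Type) [CommRing A] [IsArtinianRing A] [IsLocalRing A], IsUnit (2 : A) →
      ∀ (J : Ideal A), J ≠ ⊤ → maximalIdeal A * J = ⊥ →
      ∀ (g : ℕ) (X₀ : AbelianSchemeOver (Spec (.of (A ⧸ J)))), X₀.IsOfRelDim g →
        ∃ (X : AbelianSchemeOver (Spec (.of A))) (_ : X.IsOfRelDim g) (G : X₀.X.left ⟶ X.X.left),
          X₀.IsBaseChangeVia X (Spec.map (CommRingCat.ofHom (Ideal.Quotient.mk J))) G :=
  -- ★-IMAGE: PAID BY ★ TERM — twin ★ p854176 `Theorems/F0P6bFlatQuotient.lean` (T2′)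
  F0P6bFlatQuotient.stub_L4B1u_of_flatQuotient_of_descent hQ hD

end Summit.HodgeConjecture.HodgeConjecture.Cruxes.HLiu418.F0P6bMumfordDualFlat

end
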